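import Summits.Ventures.PercRepro.C041RcPortCSGen
import Summits.Ventures.PercRepro.C041RcPortCSBase
import Summits.Ventures.PercRepro.C041ZoneOCubeCSHub
import Summits.Ventures.PercRepro.C041ZoneOCubeCountCS
import Summits.Ventures.PercRepro.C041CutSplitCS

/-!
# ROW C-041 after gen 28 — mine-3's CONJECTURE (CS) in one place (p6, gen 28)

The end theorems of the `C041*CS*` modules, restated together with every hypothesis in the type (the referees'
«tree read» form):

* THEOREM R-CS on zone port problems, both validities — `theoremR_cs_ports`;
* THEOREM R-CS on every skeleton, no hypothesis, with THEOREM R as its AM–GM corollary — `theoremR_cs_skeleton`;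
* the (CS) closure properties: LEMMA G-CS (the cut-vertex glue, abstract and on zone port problems) and THE UNION
  LEMMA FOR (CS) — `cs_closure`;
* the crux in (CS) form: the ZONE (CS) implies the ZONE O-CUBE; on tail-free hub cores the ZONE (CS) of the indexed
  zones gives (CS) and (O-CUBE); for one anchor the ZONE (CS) is `(#F − #I)² ≤ #T₁·#T₂` — `row_C041_cs_crux`.

Every statement here is a corollary of the landed modules; nothing new is claimed.  The single open statement is the
abstract `ZoneCSConjF` (mine-3's C-041.md §17 (d)) — on zones with cycles or several anchors; on tree zones with one
anchor it is mine-3's §19 closure lemma together with the combinatorial dictionary §15 (c).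
-/

namespace PercRepro

namespace MultiGraph

open Finset ZoneZ ZonePort CSCount CutGlue

/-- **THEOREM R-CS on zone port problems**, for both validities: on every zone port problem whose zones are reached
from the root set, `(#valid − #Good₁ − #Good₂)₊² ≤ #Good₁ · #Good₂`. -/
theorem theoremR_cs_ports {V E : Type*} [Fintype E] [DecidableEq E] [DecidableEq V] (P : Problem V E)
    (hconn : P.ZonesReached) : P.CSOr ∧ P.CSAnd :=
  ⟨Problem.csOr_of_zonesReached P hconn, Problem.csAnd_of_zonesReached P hconn⟩

open Classical in
/-- **THEOREM R-CS on every skeleton**, no hypothesis, and THEOREM R as its corollary: on the sources all of whose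
attached zones are internally red-connected, `(#𝒮 − #Good_a − #Good_b)₊² ≤ #Good_a · #Good_b` and
`2·#𝒮 ≤ 3·#Good_a + 3·#Good_b`. -/
theorem theoremR_cs_skeleton {V E : Type*} [Fintype V] [Fintype E] [DecidableEq E] (G : MultiGraph V E) (a b c : V) :
    CS #(G.rcSrcAll a b c) #(G.rcGoodAAll a b c) #(G.rcGoodBAll a b c) ∧
      2 * #(G.rcSrcAll a b c) ≤ 3 * #(G.rcGoodAAll a b c) + 3 * #(G.rcGoodBAll a b c) :=
  ⟨rc_theoremR_cs a b c, two_mul_le_of_cs (rc_theoremR_cs a b c)⟩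

open Classical in
/-- **The closure properties of (CS)**: LEMMA G-CS on the abstract glue and on zone port problems with a cut vertex,
and THE UNION LEMMA FOR (CS) over any finite family of components. -/
theorem cs_closure {V E : Type*} [Fintype E] [DecidableEq E] [DecidableEq V] {Y X : Type*} [Fintype Y] [Fintype X]
    (P : Space Y) (ρ₁ ρ₂ : Y → Prop) (Q : Space X) (L : Loose V E) (sp : L.Split) {ι : Type*} [Fintype ι]
    [DecidableEq ι] {S : ι → Type*} [∀ i, Fintype (S i)] (v g h : ∀ i, S i → Prop) :
    (P.CSZ → Q.CSZ → P.I ≤ P.m₁ ρ₁ → P.I ≤ P.m₂ ρ₂ → (glue P ρ₁ ρ₂ Q).CSZ) ∧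
      (sp.gadget.CSZ → sp.far.CSZ → sp.gadget.I ≤ sp.gadget.m₁ sp.ρ₁ → sp.gadget.I ≤ sp.gadget.m₂ sp.ρ₂ →
        L.CSOrZ) ∧
      ((∀ i σ, g i σ → v i σ) → (∀ i σ, h i σ → v i σ) → (∀ i, ZoneOCube.CSInd (v i) (g i) (h i)) →
        ZoneOCube.CSInd (fun σ : ∀ i, S i => ∃ i, v i (σ i)) (fun σ => ∃ i, g i (σ i)) (fun σ => ∃ i, h i (σ i))) :=
  ⟨fun hP hQ h₁ h₂ => csZ_glue P ρ₁ ρ₂ Q hP hQ h₁ h₂, fun hP hQ h₁ h₂ => sp.csOrZ_of_split hP hQ h₁ h₂,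
    fun hg hh H => ZoneOCube.union_lemma_cs_fintype v g h hg hh H⟩

open Classical in
/-- **The crux of ROW C-041 in (CS) form**: the ZONE (CS) implies the ZONE O-CUBE; on a tail-free hub core the ZONE
(CS) of the indexed zones gives (CS) for the cube family and `0 ≤ oCube`; for one anchor without a protected anchor
the ZONE (CS) is `(#F − #I)² ≤ #T₁ · #T₂`. -/
theorem row_C041_cs_crux {V E : Type*} [Fintype V] [Fintype E] [DecidableEq E] (G : MultiGraph V E) (a b c : V)
    (hc : c ≠ a ∧ c ≠ b) (hne : a ≠ b) (hab : ∃ e, G.Joins e a b)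
    {V' E' T₁ T₂ : Type*} [Fintype E'] [DecidableEq E'] [Fintype T₁] [DecidableEq T₁] [Fintype T₂] [DecidableEq T₂]
    (F : FZone V' E' T₁ T₂) (A Q : Set V') (Z : ZoneData V' E' T₁ T₂) (k : V') :
    (F.ZoneCSConjF A Q → F.ZoneOCubeConjF A Q) ∧
      (∀ O : Config E, G.TailFree a b c O → G.HubCore a b c O →
        (∀ Z : G.ZoneIdx a b c O, (G.zoneFZ a b O Z.1).ZoneCSConjF (G.zoneA a b c O Z.1) (zoneQ c Z.1)) →
          CS #(G.cubeValidSet a b c O) #(G.cubeGoodASet a b c O) #(G.cubeGoodBSet a b c O) ∧ 0 ≤ G.oCube a b c O) ∧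
      (Z.ZoneCSConj {k} (∅ : Set V') ↔ (#(Z.Fset k) - #(Z.Iset k)) ^ 2 ≤ #(Z.T1set k) * #(Z.T2set k)) :=
  ⟨F.zoneOCubeConjF_of_zoneCSF A Q,
    fun _ hO hhub hzone => ⟨cube_cs_of_zoneCS_hub hc hne hab hO hhub hzone,
      oCube_nonneg_of_zoneCS_hub hc hne hab hO hhub hzone⟩,
    Z.zoneCSConj_single_iff k⟩

end MultiGraph

end PercRepro
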